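import Mathlib
import Summits.Ventures.PercRepro2.Defs
import Summits.Ventures.PercRepro2.Graph
import Summits.Ventures.PercRepro2.Induced
import Summits.Ventures.PercRepro2.VdBKahn
import Summits.Ventures.PercRepro2.ReimerVdBK
import Summits.Ventures.PercRepro2.ReimerVdBKRegions
import Summits.Ventures.PercRepro2.ReimerVdBKZClosed
import Summits.Ventures.PercRepro2.ReimerVdBKZReduction
import Summits.Ventures.PercRepro2.ReimerVdBKZSplit
import Summits.Ventures.PercRepro2.ReimerVdBKZRecursion
import Summits.Ventures.PercRepro2.ReimerVdBKTypeWeight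
import Summits.Ventures.PercRepro2.ReimerVdBKPairType
import Summits.Ventures.PercRepro2.ReimerVdBKCoreDown
import Summits.Ventures.PercRepro2.ReimerVdBKCoreD
import Summits.Ventures.PercRepro2.ReimerVdBKDegTwoGraph
import Summits.Ventures.PercRepro2.ReimerVdBKDegTwoFlip
import Summits.Ventures.PercRepro2.ReimerVdBKDegTwoExpansion
import Summits.Ventures.PercRepro2.ReimerVdBKDegTwoCalc
import Summits.Ventures.PercRepro2.ReimerVdBKLeafGadget
import Summits.Ventures.PercRepro2.ReimerVdBKTwisted
import Summits.Ventures.PercRepro2.ReimerVdBKTied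
import Summits.Ventures.PercRepro2.ReimerVdBKDegThreeGraph
import Summits.Ventures.PercRepro2.ReimerVdBKDegThreeExpansion
import Summits.Ventures.PercRepro2.ReimerVdBKDegThreeCalc

/-!
# The one-world degree-2 rules: a marked avoidance vertex of degree 2 is removed without a pin
(blind cell PercRepro2, mine-c g48; `conjectures/MINE-C.md` §57.5 addendum 1)

Let `v ≠ s` be a vertex of degree 2 (`Deg2`, edges `e₁ = {v, u₁}`, `e₂ = {v, u₂}`) that is AVOIDED BY ONE WORLD:
`v ∈ X` (world 1 must not reach `v`) and `v ∉ A ∪ B ∪ Y`, or `v ∈ Y` and `v ∉ A ∪ X ∪ B`.  Sorting the colourings by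
the colour pattern of the star: the two monochromatic patterns are the tied sub-cube (`coreTiedCount`); in the
pattern «`e₁` red, `e₂` blue» `v` is a leaf at `u₁` in world 1 and at `u₂` in world 2, so the avoidance of `v`
becomes the avoidance of `u₁` (for `v ∈ X`) or of `u₂` (for `v ∈ Y`) on `G° = G − v` (`mem_twoWorld_X_TF`,
`mem_twoWorld_Y_TF`); the mirror pattern swaps `u₁` and `u₂`.  Hence
`4 · coreCount A X B Y N = 4 · coreTiedCount A X B Y N {e₁, e₂} + coreCount° A (insert u₁ X) B Y N +
coreCount° A (insert u₂ X) B Y N` (`four_mul_coreCount_X`; with `Y` in place of `X`: `four_mul_coreCount_Y`),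
and THEOREMS `coreDown_X_deg2` / `coreDown_Y_deg2`: (CORE↓) at `N` on the tied sub-cube of the star
(`CoreDownTied`; Harris when `N = ∅`, `coreDownTied_of_empty`) and (CORE↓) at `N` on `G°` for the two
instances with `u₁` resp. `u₂` avoided give (CORE↓) at `N` on `G` — the right-hand instance, in which `v` is
avoided by world 2, expands by the `Y`-identity, and the two `G°`-terms match crosswise.  Unlike the degree-2
rule at an unmarked core-avoided vertex (`coreDown_insert_of_genSymN`, whose anti-tied class is the pin
statement GENSYM), these rules need NO pin: the anti-tied class of a one-world vertex is two (CORE↓)_N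
instances — with `N = ∅`, Harris twice.
-/

namespace Summit.Ventures.PercRepro2
namespace ReimerVdBK
open Classical

variable {V : Type*} {E : Type*} [Fintype E] [DecidableEq E] [Fintype V] [DecidableEq V]
variable (ends : E → Sym2 V) (s : V)

section Transfer
variable {v u₁ u₂ : V} {e₁ e₂ : E} (A X B Y : Finset V)

omit [Fintype E] [Fintype V] in
/-- **`e₁` open, `e₂` closed, `v ∈ X`**: the two-world event on `G` is the two-world event on `G°` with `u₁`
added to the world-1 avoided set (`v` is a leaf at `u₁` in world 1; it is isolated in `G°`). -/
lemma mem_twoWorld_X_TF (hd : Deg2 ends v u₁ u₂ e₁ e₂) (hsv : s ≠ v) (hvX : v ∈ X) (hv : v ∉ A ∪ B ∪ Y)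
    {ω : Config E} (h1 : ω e₁ = true) (h2 : ω e₂ = false) :
    ω ∈ twoWorld ends s A X B Y ↔ ω ∈ twoWorld (endsLoop ends v e₁ e₂) s A (insert u₁ X) B Y := by
  have hA : ∀ a ∈ A, a ≠ v := fun a ha hav => hv (hav ▸ Finset.mem_union_left _ (Finset.mem_union_left _ ha))
  have hB : ∀ b ∈ B, b ≠ v := fun b hb hbv => hv (hbv ▸ Finset.mem_union_left _ (Finset.mem_union_right _ hb))
  have hY : ∀ y ∈ Y, y ≠ v := fun y hy hyv => hv (hyv ▸ Finset.mem_union_right _ hy)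
  obtain ⟨hc1, hv1⟩ := conn_iff_endsLoop ends s hd hsv h1 h2
  have h1' : compl ω e₂ = true := by simp [compl_apply, h2]
  have h2' : compl ω e₁ = false := by simp [compl_apply, h1]
  obtain ⟨hc2, -⟩ := conn_iff_endsLoop ends s hd.swap hsv h1' h2'
  rw [endsLoop_swap ends hd.ne] at hc2
  have hiso := not_conn_endsLoop ends s hd hsv ω
  rw [mem_twoWorld_iff, mem_twoWorld_iff]
  simp only [mem_K₁, mem_K₂]
  constructor
  · rintro ⟨hA', hX', hB', hY'⟩
    refine ⟨fun a ha => (hc1 a (hA a ha)).1 (hA' a ha), ?_, fun b hb => (hc2 b (hB b hb)).1 (hB' b hb),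
      fun y hy hc => hY' y hy ((hc2 y (hY y hy)).2 hc)⟩
    intro x hx hc
    rcases Finset.mem_insert.1 hx with rfl | hx
    · exact hX' v hvX (hv1.2 hc)
    · by_cases hxv : x = v
      · subst hxv; exact hiso hc
      · exact hX' x hx ((hc1 x hxv).2 hc)
  · rintro ⟨hA', hX', hB', hY'⟩
    refine ⟨fun a ha => (hc1 a (hA a ha)).2 (hA' a ha), ?_, fun b hb => (hc2 b (hB b hb)).2 (hB' b hb),
      fun y hy hc => hY' y hy ((hc2 y (hY y hy)).1 hc)⟩
    intro x hx hc
    by_cases hxv : x = v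
    · subst hxv; exact hX' u₁ (Finset.mem_insert_self _ _) (hv1.1 hc)
    · exact hX' x (Finset.mem_insert_of_mem hx) ((hc1 x hxv).1 hc)

omit [Fintype E] [Fintype V] in
/-- **`e₁` open, `e₂` closed, `v ∈ Y`**: the two-world event on `G` is the two-world event on `G°` with `u₂`
added to the world-2 avoided set (`v` is a leaf at `u₂` in world 2). -/
lemma mem_twoWorld_Y_TF (hd : Deg2 ends v u₁ u₂ e₁ e₂) (hsv : s ≠ v) (hvY : v ∈ Y) (hv : v ∉ A ∪ X ∪ B)
    {ω : Config E} (h1 : ω e₁ = true) (h2 : ω e₂ = false) :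
    ω ∈ twoWorld ends s A X B Y ↔ ω ∈ twoWorld (endsLoop ends v e₁ e₂) s A X B (insert u₂ Y) := by
  have hA : ∀ a ∈ A, a ≠ v := fun a ha hav => hv (hav ▸ Finset.mem_union_left _ (Finset.mem_union_left _ ha))
  have hX : ∀ x ∈ X, x ≠ v := fun x hx hxv => hv (hxv ▸ Finset.mem_union_left _ (Finset.mem_union_right _ hx))
  have hB : ∀ b ∈ B, b ≠ v := fun b hb hbv => hv (hbv ▸ Finset.mem_union_right _ hb)
  obtain ⟨hc1, -⟩ := conn_iff_endsLoop ends s hd hsv h1 h2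
  have h1' : compl ω e₂ = true := by simp [compl_apply, h2]
  have h2' : compl ω e₁ = false := by simp [compl_apply, h1]
  obtain ⟨hc2, hv2⟩ := conn_iff_endsLoop ends s hd.swap hsv h1' h2'
  rw [endsLoop_swap ends hd.ne] at hc2 hv2
  have hiso := not_conn_endsLoop ends s hd hsv (compl ω)
  rw [mem_twoWorld_iff, mem_twoWorld_iff]
  simp only [mem_K₁, mem_K₂]
  constructor
  · rintro ⟨hA', hX', hB', hY'⟩
    refine ⟨fun a ha => (hc1 a (hA a ha)).1 (hA' a ha), fun x hx hc => hX' x hx ((hc1 x (hX x hx)).2 hc),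
      fun b hb => (hc2 b (hB b hb)).1 (hB' b hb), ?_⟩
    intro y hy hc
    rcases Finset.mem_insert.1 hy with rfl | hy
    · exact hY' v hvY (hv2.2 hc)
    · by_cases hyv : y = v
      · subst hyv; exact hiso hc
      · exact hY' y hy ((hc2 y hyv).2 hc)
  · rintro ⟨hA', hX', hB', hY'⟩
    refine ⟨fun a ha => (hc1 a (hA a ha)).2 (hA' a ha), fun x hx hc => hX' x hx ((hc1 x (hX x hx)).1 hc),
      fun b hb => (hc2 b (hB b hb)).2 (hB' b hb), ?_⟩
    intro y hy hc
    by_cases hyv : y = v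
    · subst hyv; exact hY' u₂ (Finset.mem_insert_self _ _) (hv2.1 hc)
    · exact hY' y (Finset.mem_insert_of_mem hy) ((hc2 y hyv).1 hc)

omit [Fintype E] [Fintype V] [DecidableEq V] in
/-- Core avoidance of `N ∌ v` transfers from `G` to `G°` in the pattern «`e₁` open, `e₂` closed». -/
lemma coreAvoid_iff_loop_TF (N : Finset V) (hd : Deg2 ends v u₁ u₂ e₁ e₂) (hsv : s ≠ v) (hvN : v ∉ N)
    {ω : Config E} (h1 : ω e₁ = true) (h2 : ω e₂ = false) :
    CoreAvoid ends s N ω ↔ CoreAvoid (endsLoop ends v e₁ e₂) s N ω := by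
  have hwN : ∀ w ∈ N, w ≠ v := fun w hw hwv => hvN (hwv ▸ hw)
  obtain ⟨hc1, -⟩ := conn_iff_endsLoop ends s hd hsv h1 h2
  have h1' : compl ω e₂ = true := by simp [compl_apply, h2]
  have h2' : compl ω e₁ = false := by simp [compl_apply, h1]
  obtain ⟨hc2, -⟩ := conn_iff_endsLoop ends s hd.swap hsv h1' h2'
  rw [endsLoop_swap ends hd.ne] at hc2
  exact coreAvoid_iff_of_conn_iff ends s N (fun w hw => hc1 w (hwN w hw)) (fun w hw => hc2 w (hwN w hw))

omit [Fintype E] [Fintype V] [DecidableEq V] in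
/-- Membership in the tied set of a pair. -/
lemma mem_tied_pair (hne : e₁ ≠ e₂) (ω : Config E) : ω ∈ tied {e₁, e₂} ↔ ω e₁ = ω e₂ := by
  unfold tied
  simp only [Set.mem_setOf_eq, Finset.mem_insert, Finset.mem_singleton]
  constructor
  · intro h; exact h e₁ (Or.inl rfl) e₂ (Or.inr rfl)
  · rintro h e he e' he'
    rcases he with rfl | rfl <;> rcases he' with rfl | rfl
    · rfl
    · exact h
    · exact h.symm
    · rfl

end Transfer

section Expansion
variable {v u₁ u₂ : V} {e₁ e₂ : E} (A X B Y N : Finset V)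

/-- The core-restricted term of an instance (no core weight at `v`). -/
noncomputable def caTerm (ends' : E → Sym2 V) (A' X' B' Y' : Finset V) (ω : Config E) : ℕ :=
  if ω ∈ twoWorld ends' s A' X' B' Y' ∧ CoreAvoid ends' s N ω then 1 else 0

/-- The core-restricted count is the sum of the terms. -/
lemma coreCount_eq_sum_caTerm (ends' : E → Sym2 V) (A' X' B' Y' : Finset V) :
    coreCount ends' s A' X' B' Y' N = ∑ ω : Config E, caTerm s N ends' A' X' B' Y' ω := by
  rw [coreCount_eq_sum_coreAvoid]
  rfl

omit [Fintype E] [Fintype V] [DecidableEq V] in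
/-- A `G°`-term is blind to the colour of a loop. -/
lemma caTerm_loop_flip (hne : e₁ ≠ e₂) {e : E} (he : e = e₁ ∨ e = e₂) (A' X' B' Y' : Finset V) (ω : Config E) :
    caTerm s N (endsLoop ends v e₁ e₂) A' X' B' Y' (flipE e ω) = caTerm s N (endsLoop ends v e₁ e₂) A' X' B' Y' ω := by
  have hloop : (endsLoop ends v e₁ e₂ e).IsDiag := by
    rcases he with rfl | rfl
    · rw [endsLoop_e₁ ends hne]; exact Sym2.mk_isDiag_iff.2 rfl
    · rw [endsLoop_e₂]; exact Sym2.mk_isDiag_iff.2 rfl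
  unfold caTerm flipE
  simp only [mem_twoWorld_update_of_loop s hloop, coreAvoid_update_of_loop s N hloop]

omit [Fintype E] [Fintype V] [DecidableEq V] in
/-- Same colour on the star: the term is the tied term (no condition at `v` is involved). -/
lemma caTerm_same (hne : e₁ ≠ e₂) {ω : Config E} (hsame : ω e₁ = ω e₂) :
    caTerm s N ends A X B Y ω = tiedFunN ends s A X B Y N {e₁, e₂} ω := by
  unfold caTerm tiedFunN
  have ht : ω ∈ tied {e₁, e₂} := (mem_tied_pair hne ω).2 hsame
  simp only [ht, true_and]

omit [Fintype E] [Fintype V] in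
/-- The pointwise split for `v ∈ X`. -/
lemma caTerm_split_X (hd : Deg2 ends v u₁ u₂ e₁ e₂) (hsv : s ≠ v) (hvX : v ∈ X) (hv : v ∉ A ∪ B ∪ Y)
    (hvN : v ∉ N) (ω : Config E) :
    caTerm s N ends A X B Y ω = sel (ω e₁) (ω e₂) (tiedFunN ends s A X B Y N {e₁, e₂} ω)
      (caTerm s N (endsLoop ends v e₁ e₂) A (insert u₁ X) B Y ω)
      (caTerm s N (endsLoop ends v e₁ e₂) A (insert u₂ X) B Y ω) := by
  cases h1 : ω e₁ <;> cases h2 : ω e₂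
  · show caTerm s N ends A X B Y ω = tiedFunN ends s A X B Y N {e₁, e₂} ω
    exact caTerm_same ends s A X B Y N hd.ne (h1.trans h2.symm)
  · show caTerm s N ends A X B Y ω = caTerm s N (endsLoop ends v e₁ e₂) A (insert u₂ X) B Y ω
    have h1' : ω e₂ = true := h2
    have h2' : ω e₁ = false := h1
    have htw := mem_twoWorld_X_TF ends s A X B Y hd.swap hsv hvX hv h1' h2'
    have hca := coreAvoid_iff_loop_TF ends s N hd.swap hsv hvN h1' h2'
    rw [endsLoop_swap ends hd.ne] at htw hca
    unfold caTerm
    rw [htw, hca]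
  · show caTerm s N ends A X B Y ω = caTerm s N (endsLoop ends v e₁ e₂) A (insert u₁ X) B Y ω
    have htw := mem_twoWorld_X_TF ends s A X B Y hd hsv hvX hv h1 h2
    have hca := coreAvoid_iff_loop_TF ends s N hd hsv hvN h1 h2
    unfold caTerm
    rw [htw, hca]
  · show caTerm s N ends A X B Y ω = tiedFunN ends s A X B Y N {e₁, e₂} ω
    exact caTerm_same ends s A X B Y N hd.ne (h1.trans h2.symm)

omit [Fintype E] [Fintype V] in
/-- The pointwise split for `v ∈ Y`. -/
lemma caTerm_split_Y (hd : Deg2 ends v u₁ u₂ e₁ e₂) (hsv : s ≠ v) (hvY : v ∈ Y) (hv : v ∉ A ∪ X ∪ B)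
    (hvN : v ∉ N) (ω : Config E) :
    caTerm s N ends A X B Y ω = sel (ω e₁) (ω e₂) (tiedFunN ends s A X B Y N {e₁, e₂} ω)
      (caTerm s N (endsLoop ends v e₁ e₂) A X B (insert u₂ Y) ω)
      (caTerm s N (endsLoop ends v e₁ e₂) A X B (insert u₁ Y) ω) := by
  cases h1 : ω e₁ <;> cases h2 : ω e₂
  · show caTerm s N ends A X B Y ω = tiedFunN ends s A X B Y N {e₁, e₂} ω
    exact caTerm_same ends s A X B Y N hd.ne (h1.trans h2.symm)
  · show caTerm s N ends A X B Y ω = caTerm s N (endsLoop ends v e₁ e₂) A X B (insert u₁ Y) ω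
    have h1' : ω e₂ = true := h2
    have h2' : ω e₁ = false := h1
    have htw := mem_twoWorld_Y_TF ends s A X B Y hd.swap hsv hvY hv h1' h2'
    have hca := coreAvoid_iff_loop_TF ends s N hd.swap hsv hvN h1' h2'
    rw [endsLoop_swap ends hd.ne] at htw hca
    unfold caTerm
    rw [htw, hca]
  · show caTerm s N ends A X B Y ω = caTerm s N (endsLoop ends v e₁ e₂) A X B (insert u₂ Y) ω
    have htw := mem_twoWorld_Y_TF ends s A X B Y hd hsv hvY hv h1 h2
    have hca := coreAvoid_iff_loop_TF ends s N hd hsv hvN h1 h2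
    unfold caTerm
    rw [htw, hca]
  · show caTerm s N ends A X B Y ω = tiedFunN ends s A X B Y N {e₁, e₂} ω
    exact caTerm_same ends s A X B Y N hd.ne (h1.trans h2.symm)

omit [Fintype V] [DecidableEq V] in
/-- The sum of the tied terms over the monochromatic colourings is the tied count. -/
lemma sum_tied_same (hne : e₁ ≠ e₂) :
    ∑ ω : Config E, (if ω e₁ = ω e₂ then tiedFunN ends s A X B Y N {e₁, e₂} ω else 0) =
      coreTiedCount ends s A X B Y N {e₁, e₂} := by
  unfold coreTiedCount
  refine Finset.sum_congr rfl fun ω _ => ?_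
  by_cases h : ω e₁ = ω e₂
  · rw [if_pos h]
  · rw [if_neg h]
    unfold tiedFunN
    rw [if_neg]
    rintro ⟨-, ht, -⟩
    exact h ((mem_tied_pair hne ω).1 ht)

/-- **The expansion at a degree-2 vertex `v ∈ X`**: `4 · coreCount A X B Y N = 4 · coreTiedCount A X B Y N {e₁, e₂} +
coreCount° A (insert u₁ X) B Y N + coreCount° A (insert u₂ X) B Y N`. -/
theorem four_mul_coreCount_X (hd : Deg2 ends v u₁ u₂ e₁ e₂) (hsv : s ≠ v) (hvX : v ∈ X) (hv : v ∉ A ∪ B ∪ Y)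
    (hvN : v ∉ N) :
    4 * coreCount ends s A X B Y N = 4 * coreTiedCount ends s A X B Y N {e₁, e₂} +
      (coreCount (endsLoop ends v e₁ e₂) s A (insert u₁ X) B Y N +
        coreCount (endsLoop ends v e₁ e₂) s A (insert u₂ X) B Y N) := by
  have hsplit : ∑ ω : Config E, caTerm s N ends A X B Y ω =
      ∑ ω : Config E, (if ω e₁ = ω e₂ then tiedFunN ends s A X B Y N {e₁, e₂} ω else 0) +
        (∑ ω : Config E, (if ω e₁ = true ∧ ω e₂ = false then
            caTerm s N (endsLoop ends v e₁ e₂) A (insert u₁ X) B Y ω else 0) +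
          ∑ ω : Config E, (if ω e₁ = false ∧ ω e₂ = true then
            caTerm s N (endsLoop ends v e₁ e₂) A (insert u₂ X) B Y ω else 0)) := by
    rw [← sum_sel]
    exact Finset.sum_congr rfl fun ω _ => caTerm_split_X ends s A X B Y N hd hsv hvX hv hvN ω
  have h1 := four_mul_sum_pattern e₁ e₂ hd.ne (caTerm s N (endsLoop ends v e₁ e₂) A (insert u₁ X) B Y)
    (fun ω => caTerm_loop_flip ends s N hd.ne (Or.inl rfl) A (insert u₁ X) B Y ω)
    (fun ω => caTerm_loop_flip ends s N hd.ne (Or.inr rfl) A (insert u₁ X) B Y ω) true false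
  have h2 := four_mul_sum_pattern e₁ e₂ hd.ne (caTerm s N (endsLoop ends v e₁ e₂) A (insert u₂ X) B Y)
    (fun ω => caTerm_loop_flip ends s N hd.ne (Or.inl rfl) A (insert u₂ X) B Y ω)
    (fun ω => caTerm_loop_flip ends s N hd.ne (Or.inr rfl) A (insert u₂ X) B Y ω) false true
  rw [coreCount_eq_sum_caTerm, hsplit, sum_tied_same ends s A X B Y N hd.ne,
    coreCount_eq_sum_caTerm, coreCount_eq_sum_caTerm]
  omega

/-- **The expansion at a degree-2 vertex `v ∈ Y`**: `4 · coreCount A X B Y N = 4 · coreTiedCount A X B Y N {e₁, e₂} +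
coreCount° A X B (insert u₂ Y) N + coreCount° A X B (insert u₁ Y) N`. -/
theorem four_mul_coreCount_Y (hd : Deg2 ends v u₁ u₂ e₁ e₂) (hsv : s ≠ v) (hvY : v ∈ Y) (hv : v ∉ A ∪ X ∪ B)
    (hvN : v ∉ N) :
    4 * coreCount ends s A X B Y N = 4 * coreTiedCount ends s A X B Y N {e₁, e₂} +
      (coreCount (endsLoop ends v e₁ e₂) s A X B (insert u₂ Y) N +
        coreCount (endsLoop ends v e₁ e₂) s A X B (insert u₁ Y) N) := by
  have hsplit : ∑ ω : Config E, caTerm s N ends A X B Y ω =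
      ∑ ω : Config E, (if ω e₁ = ω e₂ then tiedFunN ends s A X B Y N {e₁, e₂} ω else 0) +
        (∑ ω : Config E, (if ω e₁ = true ∧ ω e₂ = false then
            caTerm s N (endsLoop ends v e₁ e₂) A X B (insert u₂ Y) ω else 0) +
          ∑ ω : Config E, (if ω e₁ = false ∧ ω e₂ = true then
            caTerm s N (endsLoop ends v e₁ e₂) A X B (insert u₁ Y) ω else 0)) := by
    rw [← sum_sel]
    exact Finset.sum_congr rfl fun ω _ => caTerm_split_Y ends s A X B Y N hd hsv hvY hv hvN ω
  have h1 := four_mul_sum_pattern e₁ e₂ hd.ne (caTerm s N (endsLoop ends v e₁ e₂) A X B (insert u₂ Y))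
    (fun ω => caTerm_loop_flip ends s N hd.ne (Or.inl rfl) A X B (insert u₂ Y) ω)
    (fun ω => caTerm_loop_flip ends s N hd.ne (Or.inr rfl) A X B (insert u₂ Y) ω) true false
  have h2 := four_mul_sum_pattern e₁ e₂ hd.ne (caTerm s N (endsLoop ends v e₁ e₂) A X B (insert u₁ Y))
    (fun ω => caTerm_loop_flip ends s N hd.ne (Or.inl rfl) A X B (insert u₁ Y) ω)
    (fun ω => caTerm_loop_flip ends s N hd.ne (Or.inr rfl) A X B (insert u₁ Y) ω) false true
  rw [coreCount_eq_sum_caTerm, hsplit, sum_tied_same ends s A X B Y N hd.ne,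
    coreCount_eq_sum_caTerm, coreCount_eq_sum_caTerm]
  omega

/-- **The one-world degree-2 rule at `v ∈ X`**: (CORE↓) at `N` on the tied sub-cube of the star and (CORE↓) at `N`
on `G°` for the two instances with `u₁` resp. `u₂` added to `X` give (CORE↓) at `N` on `G`. -/
theorem coreDown_X_deg2 (hd : Deg2 ends v u₁ u₂ e₁ e₂) (hsv : s ≠ v) (hvX : v ∈ X) (hv : v ∉ A ∪ B ∪ Y)
    (hvN : v ∉ N) (hT : CoreDownTied ends s A X B Y N {e₁, e₂})
    (h1 : CoreDown (endsLoop ends v e₁ e₂) s A (insert u₁ X) B Y N)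
    (h2 : CoreDown (endsLoop ends v e₁ e₂) s A (insert u₂ X) B Y N) :
    CoreDown ends s A X B Y N := by
  have hvR : v ∈ X ∪ Y := Finset.mem_union_left _ hvX
  have hv' : v ∉ (A ∪ B) ∪ ∅ ∪ ∅ := by
    rw [Finset.union_empty, Finset.union_empty]
    intro h
    rcases Finset.mem_union.1 h with h | h
    · exact hv (Finset.mem_union_left _ (Finset.mem_union_left _ h))
    · exact hv (Finset.mem_union_left _ (Finset.mem_union_right _ h))
  have hL := four_mul_coreCount_X ends s A X B Y N hd hsv hvX hv hvN
  have hR := four_mul_coreCount_Y ends s (A ∪ B) ∅ ∅ (X ∪ Y) N hd hsv hvR hv' hvN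
  unfold CoreDown at h1 h2 ⊢
  unfold CoreDownTied at hT
  rw [Finset.insert_union] at h1 h2
  have : 4 * coreCount ends s A X B Y N ≤ 4 * coreCount ends s (A ∪ B) ∅ ∅ (X ∪ Y) N := by
    rw [hL, hR]
    have := Nat.add_le_add h1 h2
    omega
  exact Nat.le_of_mul_le_mul_left this (by norm_num)

/-- **The one-world degree-2 rule at `v ∈ Y`**: (CORE↓) at `N` on the tied sub-cube of the star and (CORE↓) at `N`
on `G°` for the two instances with `u₂` resp. `u₁` added to `Y` give (CORE↓) at `N` on `G`. -/
theorem coreDown_Y_deg2 (hd : Deg2 ends v u₁ u₂ e₁ e₂) (hsv : s ≠ v) (hvY : v ∈ Y) (hv : v ∉ A ∪ X ∪ B)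
    (hvN : v ∉ N) (hT : CoreDownTied ends s A X B Y N {e₁, e₂})
    (h1 : CoreDown (endsLoop ends v e₁ e₂) s A X B (insert u₂ Y) N)
    (h2 : CoreDown (endsLoop ends v e₁ e₂) s A X B (insert u₁ Y) N) :
    CoreDown ends s A X B Y N := by
  have hvR : v ∈ X ∪ Y := Finset.mem_union_right _ hvY
  have hv' : v ∉ (A ∪ B) ∪ ∅ ∪ ∅ := by
    rw [Finset.union_empty, Finset.union_empty]
    intro h
    rcases Finset.mem_union.1 h with h | h
    · exact hv (Finset.mem_union_left _ (Finset.mem_union_left _ h))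
    · exact hv (Finset.mem_union_right _ h)
  have hL := four_mul_coreCount_Y ends s A X B Y N hd hsv hvY hv hvN
  have hR := four_mul_coreCount_Y ends s (A ∪ B) ∅ ∅ (X ∪ Y) N hd hsv hvR hv' hvN
  unfold CoreDown at h1 h2 ⊢
  unfold CoreDownTied at hT
  rw [Finset.union_insert] at h1 h2
  have : 4 * coreCount ends s A X B Y N ≤ 4 * coreCount ends s (A ∪ B) ∅ ∅ (X ∪ Y) N := by
    rw [hL, hR]
    have := Nat.add_le_add h1 h2
    omega
  exact Nat.le_of_mul_le_mul_left this (by norm_num)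

end Expansion

end ReimerVdBK
end Summit.Ventures.PercRepro2
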